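import Summits.KontsevichZagierPeriods.KontsevichZagierPeriods.Statement
import Summits.KontsevichZagierPeriods.KontsevichZagierPeriods.Theses.HermiteRigidity
import Summits.KontsevichZagierPeriods.KontsevichZagierPeriods.Theorems.HermiteRigidityReductionRigidityOfCubes
import Summits.KontsevichZagierPeriods.KontsevichZagierPeriods.Theorems.FurushoPentagonSectorToKernelCubeResolutionOfNash
import Summits.KontsevichZagierPeriods.KontsevichZagierPeriods.Theorems.FurushoPentagonSectorToKernelSaAnalyticOffSmall
import Summits.KontsevichZagierPeriods.KontsevichZagierPeriods.Theorems.FurushoPentagonSectorToKernelAffineOpenBand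
import Summits.KontsevichZagierPeriods.KontsevichZagierPeriods.Theorems.FurushoPentagonSectorToKernelCadRefine
import Summits.KontsevichZagierPeriods.KontsevichZagierPeriods.Theorems.FurushoPentagonSectorToKernelCadCellFacts
import Summits.KontsevichZagierPeriods.KontsevichZagierPeriods.Theorems.FurushoPentagonSectorToKernelNashCellReductionOf
import Summits.KontsevichZagierPeriods.KontsevichZagierPeriods.Theorems.FurushoPentagonSectorToKernelPowerSubstToTame

/-!
# Line `laurent-tiling` — crux `CubeResolution` (stmt-KontsevichZagierPeriods-17978) and, through the
# landed glue, crux `ReductionRigidity` (stmt-KontsevichZagierPeriods-3407), route HermiteRigidity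

Crux-strategist cycle s2 (2026-08-17).  REFINEMENT of the registered line `nash-rectilinearisation`
(strategist r1) at its one remaining theorem-grade stub.  State of the parent line on 2026-08-17 09:10Z:

* `stub_nashCellReduction` (bounded volume ≡ open-cube Nash classes) is a THEOREM — the FurushoPentagon
  lead c22 (crux stmt-10813, line `effective-cube-surjection`, skeleton v7) landed its ingredients
  A `stub_saAnalyticOffSmall` (p147371), B `stub_affineOpenBand` (p147423), C `stub_cadRefine` (p147390),
  D `stub_cadCellFacts` (p148206) and the conditional composition F `stub_nashCellReductionOf` (p148522);
  `nashCellReduction` below is their `exact` composition (copied from v7);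
* `stub_openCubeNashResolution` =: G (an open-cube Nash class is congruent to the tame cubical span) is
  the ONLY theorem-grade open stub of `CubeResolution` hub-wide, XL, and staffed by nobody ("NOT staffed
  by this lead", v7).

This file cuts G BY LANGUAGE into three genuine lemmas and proves G, `CubeResolution` (item 17978 BY
NAME) and — with item 18116 `AyoubEffectiveCubeKernel` as a named hypothesis — `ReductionRigidity`
(item 3407 BY NAME) from them, sorry-free:

* T `stub_laurentTiling` (XL, PURE REAL-ALGEBRAIC/ANALYTIC GEOMETRY — no `IntegralRep`, no `relations`):
  an integrable `ℚ`-semialgebraic function `J`, real analytic on the open cube, admits a finite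
  `ℚ`-semialgebraic TILING of the open cube by injective `C¹` charts `Φₖ` of the open cube into itself
  (images pairwise null-disjoint, of full measure) whose weighted pull-backs `(J ∘ Φₖ)·|det Φₖ'|` are
  LAURENT-TAME: `gₖ(x) / x^{Aₖ}` with `gₖ` analytic on a neighbourhood of the CLOSED cube and `Aₖ ∈ ℕᵐ`.
  (Embedded resolution of `{a_d · discr · ∏ xᵢ(1−xᵢ) = 0}` over `ℚ` + Abhyankar–Jung on the orthant
  sectors + a Kuhn/Whitehead cubulation subordinate to adapted charts + the cube→simplex monomial map +
  `t = τ^q`; or Binyamini–Novikov's real cellular parametrisation (arXiv:1802.07577, CPT Thm 8 + CPrT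
  Thm 7 + monomialisation Lemma 17) upgraded from covers to partitions.  The TILING, not the local
  monomialisation, is the load-bearing point: covers do not suffice for rule (1a).)
* E `stub_integrableLaurentExtends` (M/L, PURE ANALYSIS): if `g` is analytic on a neighbourhood of the
  closed cube and `g(x)/x^A` is integrable on the open cube then `g(x)/x^A` extends analytically to a
  neighbourhood of the closed cube (Fubini + one-variable Taylor coefficients + identity theorem:
  integrability kills the negative exponents; this is where absolute convergence enters).
* S `stub_tilingToTame` (M, MOVES ONLY): a finite null-disjoint full-measure family of injective
  `ℚ`-semialgebraic `C¹` charts of the open cube with TAME weighted pull-backs turns `[(0,1)ᵐ, J]` into a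
  `ℤ`-combination of tame cube classes modulo `KZ.relations`: rule (1a) across the null walls
  (`KZ.of_sub_sum_of_mem_relations`), rule (2) chart by chart (`KZ.changeOfVariablesRel`, exactly its
  hypotheses), closed vs open cube (`KZ.of_sub_of_mem_relations_of_null`, `volume_cube_diff_openCube`),
  semialgebraicity of the tame integrand on the closed cube by continuity
  (`stokesCal_isSemialgebraicFunOn_of_subset_closure`) — the `K`-chart generalisation of the landed
  one-chart `powerSubstToTame` (p148223).

Compositions (all sorry-free below): `openCubeNashResolution_of : T → E → S → G` (G = r1's stub,
VERBATIM, so the parent skeleton and the 10813 lead's v7 close from these three), `CubeResolution_of :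
CubeResolution` (closure induction + `nashCellReduction` + Viu-Sos `cubeResolution_of_boundedVolumes`),
`ReductionRigidity_of_ayoub : AyoubEffectiveCubeKernel → ReductionRigidity`
(`reductionRigidityOfCubes_proof`, item 18142, landed).
-/

noncomputable section

-- `Summit.KontsevichZagierPeriods.KontsevichZagierPeriods.…` is the tree's mandated layout (single-conjunct summit).
set_option linter.dupNamespace false

namespace Summit.KontsevichZagierPeriods.KontsevichZagierPeriods.Cruxes.CubeResolution.LaurentTiling

open Set MeasureTheory
open Literature.ModelTheory.ExponentialFields
open Literature.NumberTheory.Transcendental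
open Literature.NumberTheory.Transcendental.KZ hiding cubicalSpan
open Summit.KontsevichZagierPeriods.FurushoPentagon.ReducedPeriodRing (unitCube cubicalGens cubicalSpan)
open Summit.KontsevichZagierPeriods.FurushoPentagon.SectorToKernel
open Summit.KontsevichZagierPeriods.KontsevichZagierPeriods.Theses.HermiteRigidity
  (CubeResolution AyoubEffectiveCubeKernel ReductionRigidity)

/-! ## The three registered stubs -/

/-- STUB T (XL, hardest; PURE GEOMETRY) — **Laurent tiling of an integrable Nash integrand on the open
cube.**  For `J` `ℚ`-semialgebraic, real analytic and absolutely integrable on the open cube `(0,1)ᵐ`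
there are finitely many charts `Φₖ : (0,1)ᵐ → (0,1)ᵐ`, `ℚ`-semialgebraic, differentiable (derivative
`Φₖ'` within the open cube, with `ℚ`-semialgebraic `|det Φₖ'|`), injective, with pairwise null-disjoint
images of full total measure, such that each weighted pull-back is LAURENT-TAME:
`J (Φₖ x) · |det Φₖ' x| = gₖ x / ∏ᵢ xᵢ^{Aₖ i}` on the open cube, `gₖ` analytic on a neighbourhood of the
closed cube `[0,1]ᵐ`, `Aₖ i ∈ ℕ`.  Expected proof: embedded resolution over `ℚ` of the hypersurface
`a_d · discr_y(P) · ∏ xᵢ(1 − xᵢ) = 0` (`P` the minimal polynomial of `J`), Abhyankar–Jung for the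
quasi-ordinary root `a_d J` on each orthant sector, a cubulation of the compact preimage of the closed
cube subordinate to finitely many `ℚ`-Nash charts adapted to the normal-crossings divisor (Kuhn
simplices of rational grids, Whitehead gluing), the monomial map cube → simplex
`t ↦ (t₁, t₁t₂, …, t₁⋯tₘ)` and the power substitution `t = τ^q`; alternatively Binyamini–Novikov real
cellular parametrisation upgraded to a partition.  [cite: Hironaka1964] [cite: BierstoneMilman1997, Thm. 1.6]
[cite: ParusinskiRond2012, Thm. 1.1] [cite: BinyaminiNovikov2019, Thm. 8, Thm. 7, Lemma 17]
[cite: Whitehead1940, Thm. 7] -/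
theorem stub_laurentTiling : ∀ (m : ℕ) (J : (Fin m → ℝ) → ℝ),
    IsSemialgebraicFunOn ℚ {x : Fin m → ℝ | ∀ i, 0 < x i ∧ x i < 1} J →
    AnalyticOnNhd ℝ J {x : Fin m → ℝ | ∀ i, 0 < x i ∧ x i < 1} →
    IntegrableOn J {x : Fin m → ℝ | ∀ i, 0 < x i ∧ x i < 1} →
    ∃ (K : ℕ) (Φ : Fin K → (Fin m → ℝ) → (Fin m → ℝ))
      (Φ' : Fin K → (Fin m → ℝ) → ((Fin m → ℝ) →L[ℝ] (Fin m → ℝ)))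
      (g : Fin K → (Fin m → ℝ) → ℝ) (A : Fin K → Fin m → ℕ),
      (∀ k, IsSemialgebraicMapOn ℚ {x : Fin m → ℝ | ∀ i, 0 < x i ∧ x i < 1} (Φ k)) ∧
      (∀ k, ∀ x ∈ {x : Fin m → ℝ | ∀ i, 0 < x i ∧ x i < 1},
        HasFDerivWithinAt (Φ k) (Φ' k x) {x : Fin m → ℝ | ∀ i, 0 < x i ∧ x i < 1} x) ∧
      (∀ k, InjOn (Φ k) {x : Fin m → ℝ | ∀ i, 0 < x i ∧ x i < 1}) ∧
      (∀ k, Φ k '' {x : Fin m → ℝ | ∀ i, 0 < x i ∧ x i < 1} ⊆ {x : Fin m → ℝ | ∀ i, 0 < x i ∧ x i < 1}) ∧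
      (∀ k l, k ≠ l → volume (Φ k '' {x : Fin m → ℝ | ∀ i, 0 < x i ∧ x i < 1} ∩
        Φ l '' {x : Fin m → ℝ | ∀ i, 0 < x i ∧ x i < 1}) = 0) ∧
      volume ({x : Fin m → ℝ | ∀ i, 0 < x i ∧ x i < 1} \
        ⋃ k, Φ k '' {x : Fin m → ℝ | ∀ i, 0 < x i ∧ x i < 1}) = 0 ∧
      (∀ k, IsSemialgebraicFunOn ℚ {x : Fin m → ℝ | ∀ i, 0 < x i ∧ x i < 1} (fun x => |(Φ' k x).det|)) ∧
      (∀ k, AnalyticOnNhd ℝ (g k) {x : Fin m → ℝ | ∀ i, 0 ≤ x i ∧ x i ≤ 1}) ∧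
      (∀ k, ∀ x ∈ {x : Fin m → ℝ | ∀ i, 0 < x i ∧ x i < 1},
        J (Φ k x) * |(Φ' k x).det| = g k x / ∏ i, x i ^ (A k i)) := by
  sorry

/-- STUB E (M/L; PURE ANALYSIS) — **integrability kills the negative exponents.**  If `g` is real
analytic on a neighbourhood of the closed cube `[0,1]ᵐ` and `x ↦ g x / ∏ᵢ xᵢ^{Aᵢ}` is integrable on the
open cube, then it agrees there with a function analytic on a neighbourhood of the closed cube (for each
`i`, Fubini gives integrability of `t ↦ g(…,t,…)/t^{Aᵢ}` near `0` for a.e. value of the other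
coordinates, which forces the Taylor coefficients of `g` in `xᵢ` of order `< Aᵢ` to vanish a.e., hence
identically by the identity theorem; so `xᵢ^{Aᵢ}` divides `g` in the ring of germs of analytic functions
along the face, and one inducts on `∑ Aᵢ`).  This is the only place where ABSOLUTE CONVERGENCE of the
integral representation is used by the line. [cite: HuberMullerStachPeriods2017, Lemma 12.2.2] [folklore] -/
theorem stub_integrableLaurentExtends : ∀ (m : ℕ) (A : Fin m → ℕ) (g : (Fin m → ℝ) → ℝ),
    AnalyticOnNhd ℝ g {x : Fin m → ℝ | ∀ i, 0 ≤ x i ∧ x i ≤ 1} →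
    IntegrableOn (fun x => g x / ∏ i, x i ^ (A i)) {x : Fin m → ℝ | ∀ i, 0 < x i ∧ x i < 1} →
    ∃ h : (Fin m → ℝ) → ℝ, AnalyticOnNhd ℝ h {x : Fin m → ℝ | ∀ i, 0 ≤ x i ∧ x i ≤ 1} ∧
      EqOn h (fun x => g x / ∏ i, x i ^ (A i)) {x : Fin m → ℝ | ∀ i, 0 < x i ∧ x i < 1} := by
  sorry

/-- STUB S (M; MOVES ONLY) — **a tame tiling is a move chain.**  If the open cube is tiled (up to null
sets) by finitely many injective `ℚ`-semialgebraic differentiable charts `Φₖ` of the open cube into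
itself, and each weighted pull-back `(v ∘ Φₖ)·|det Φₖ'|` of the integrand of `v = [(0,1)ᵐ, f]` agrees on
the open cube with a function `hₖ` analytic on a neighbourhood of the closed cube, then `[v]` is
congruent modulo `KZ.relations` to a `ℤ`-combination of tame cube classes (indeed to `∑ₖ [[0,1]ᵐ, hₖ]`):
rule (1a) across the null walls (`KZ.of_sub_sum_of_mem_relations`), one rule-(2) move per chart (the
source representations are integrable by `MeasureTheory.integrableOn_image_iff_integrableOn_abs_det_fderiv_smul`),
then open ↔ closed cube (`KZ.of_sub_of_mem_relations_of_null`, `volume_cube_diff_openCube`) with `hₖ`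
semialgebraic on the closed cube by continuity (`stokesCal_isSemialgebraicFunOn_of_subset_closure`).  The
`K`-chart generalisation of the landed one-chart `powerSubstToTame`.
[cite: KontsevichZagier2001, §1.2 rules (1),(2)] [cite: HuberMullerStachPeriods2017, Lemma 12.2.2] -/
theorem stub_tilingToTame : ∀ (m : ℕ) (v : IntegralRep m),
    v.domain = {x : Fin m → ℝ | ∀ i, 0 < x i ∧ x i < 1} →
    ∀ (K : ℕ) (Φ : Fin K → (Fin m → ℝ) → (Fin m → ℝ))
      (Φ' : Fin K → (Fin m → ℝ) → ((Fin m → ℝ) →L[ℝ] (Fin m → ℝ)))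
      (h : Fin K → (Fin m → ℝ) → ℝ),
      (∀ k, IsSemialgebraicMapOn ℚ {x : Fin m → ℝ | ∀ i, 0 < x i ∧ x i < 1} (Φ k)) →
      (∀ k, ∀ x ∈ {x : Fin m → ℝ | ∀ i, 0 < x i ∧ x i < 1},
        HasFDerivWithinAt (Φ k) (Φ' k x) {x : Fin m → ℝ | ∀ i, 0 < x i ∧ x i < 1} x) →
      (∀ k, InjOn (Φ k) {x : Fin m → ℝ | ∀ i, 0 < x i ∧ x i < 1}) →
      (∀ k, Φ k '' {x : Fin m → ℝ | ∀ i, 0 < x i ∧ x i < 1} ⊆ {x : Fin m → ℝ | ∀ i, 0 < x i ∧ x i < 1}) →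
      (∀ k l, k ≠ l → volume (Φ k '' {x : Fin m → ℝ | ∀ i, 0 < x i ∧ x i < 1} ∩
        Φ l '' {x : Fin m → ℝ | ∀ i, 0 < x i ∧ x i < 1}) = 0) →
      volume ({x : Fin m → ℝ | ∀ i, 0 < x i ∧ x i < 1} \
        ⋃ k, Φ k '' {x : Fin m → ℝ | ∀ i, 0 < x i ∧ x i < 1}) = 0 →
      (∀ k, IsSemialgebraicFunOn ℚ {x : Fin m → ℝ | ∀ i, 0 < x i ∧ x i < 1} (fun x => |(Φ' k x).det|)) →
      (∀ k, AnalyticOnNhd ℝ (h k) {x : Fin m → ℝ | ∀ i, 0 ≤ x i ∧ x i ≤ 1}) →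
      (∀ k, ∀ x ∈ {x : Fin m → ℝ | ∀ i, 0 < x i ∧ x i < 1},
        v.integrand (Φ k x) * |(Φ' k x).det| = h k x) →
      ∃ c ∈ AddSubgroup.closure {d : FormalRep | ∃ (n : ℕ) (r : IntegralRep n),
        r.domain = {x : Fin n → ℝ | ∀ i, 0 ≤ x i ∧ x i ≤ 1} ∧
        AnalyticOnNhd ℝ r.integrand {x : Fin n → ℝ | ∀ i, 0 ≤ x i ∧ x i ≤ 1} ∧ d = of r},
        of v - c ∈ relations := by
  sorry

/-! ## Compositions (sorry-free) -/

/-- **G from T, E, S** — the registered stub `stub_openCubeNashResolution` of line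
`nash-rectilinearisation` (item 17978; = stub G of the 10813 lead's skeleton v7), VERBATIM, from the three
stubs of this line: tile (T), transfer integrability to each chart by the Jacobian formula and upgrade the
Laurent-tame pull-backs to tame ones (E), then run the moves (S). [folklore]
[cite: KontsevichZagier2001, §1.2 rules (1),(2)] -/
theorem openCubeNashResolution_of_stubs
    (hT : ∀ (m : ℕ) (J : (Fin m → ℝ) → ℝ),
      IsSemialgebraicFunOn ℚ {x : Fin m → ℝ | ∀ i, 0 < x i ∧ x i < 1} J →
      AnalyticOnNhd ℝ J {x : Fin m → ℝ | ∀ i, 0 < x i ∧ x i < 1} →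
      IntegrableOn J {x : Fin m → ℝ | ∀ i, 0 < x i ∧ x i < 1} →
      ∃ (K : ℕ) (Φ : Fin K → (Fin m → ℝ) → (Fin m → ℝ))
        (Φ' : Fin K → (Fin m → ℝ) → ((Fin m → ℝ) →L[ℝ] (Fin m → ℝ)))
        (g : Fin K → (Fin m → ℝ) → ℝ) (A : Fin K → Fin m → ℕ),
        (∀ k, IsSemialgebraicMapOn ℚ {x : Fin m → ℝ | ∀ i, 0 < x i ∧ x i < 1} (Φ k)) ∧
        (∀ k, ∀ x ∈ {x : Fin m → ℝ | ∀ i, 0 < x i ∧ x i < 1},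
          HasFDerivWithinAt (Φ k) (Φ' k x) {x : Fin m → ℝ | ∀ i, 0 < x i ∧ x i < 1} x) ∧
        (∀ k, InjOn (Φ k) {x : Fin m → ℝ | ∀ i, 0 < x i ∧ x i < 1}) ∧
        (∀ k, Φ k '' {x : Fin m → ℝ | ∀ i, 0 < x i ∧ x i < 1} ⊆ {x : Fin m → ℝ | ∀ i, 0 < x i ∧ x i < 1}) ∧
        (∀ k l, k ≠ l → volume (Φ k '' {x : Fin m → ℝ | ∀ i, 0 < x i ∧ x i < 1} ∩
          Φ l '' {x : Fin m → ℝ | ∀ i, 0 < x i ∧ x i < 1}) = 0) ∧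
        volume ({x : Fin m → ℝ | ∀ i, 0 < x i ∧ x i < 1} \
          ⋃ k, Φ k '' {x : Fin m → ℝ | ∀ i, 0 < x i ∧ x i < 1}) = 0 ∧
        (∀ k, IsSemialgebraicFunOn ℚ {x : Fin m → ℝ | ∀ i, 0 < x i ∧ x i < 1} (fun x => |(Φ' k x).det|)) ∧
        (∀ k, AnalyticOnNhd ℝ (g k) {x : Fin m → ℝ | ∀ i, 0 ≤ x i ∧ x i ≤ 1}) ∧
        (∀ k, ∀ x ∈ {x : Fin m → ℝ | ∀ i, 0 < x i ∧ x i < 1},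
          J (Φ k x) * |(Φ' k x).det| = g k x / ∏ i, x i ^ (A k i)))
    (hE : ∀ (m : ℕ) (A : Fin m → ℕ) (g : (Fin m → ℝ) → ℝ),
      AnalyticOnNhd ℝ g {x : Fin m → ℝ | ∀ i, 0 ≤ x i ∧ x i ≤ 1} →
      IntegrableOn (fun x => g x / ∏ i, x i ^ (A i)) {x : Fin m → ℝ | ∀ i, 0 < x i ∧ x i < 1} →
      ∃ h : (Fin m → ℝ) → ℝ, AnalyticOnNhd ℝ h {x : Fin m → ℝ | ∀ i, 0 ≤ x i ∧ x i ≤ 1} ∧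
        EqOn h (fun x => g x / ∏ i, x i ^ (A i)) {x : Fin m → ℝ | ∀ i, 0 < x i ∧ x i < 1})
    (hS : ∀ (m : ℕ) (v : IntegralRep m),
      v.domain = {x : Fin m → ℝ | ∀ i, 0 < x i ∧ x i < 1} →
      ∀ (K : ℕ) (Φ : Fin K → (Fin m → ℝ) → (Fin m → ℝ))
        (Φ' : Fin K → (Fin m → ℝ) → ((Fin m → ℝ) →L[ℝ] (Fin m → ℝ)))
        (h : Fin K → (Fin m → ℝ) → ℝ),
        (∀ k, IsSemialgebraicMapOn ℚ {x : Fin m → ℝ | ∀ i, 0 < x i ∧ x i < 1} (Φ k)) →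
        (∀ k, ∀ x ∈ {x : Fin m → ℝ | ∀ i, 0 < x i ∧ x i < 1},
          HasFDerivWithinAt (Φ k) (Φ' k x) {x : Fin m → ℝ | ∀ i, 0 < x i ∧ x i < 1} x) →
        (∀ k, InjOn (Φ k) {x : Fin m → ℝ | ∀ i, 0 < x i ∧ x i < 1}) →
        (∀ k, Φ k '' {x : Fin m → ℝ | ∀ i, 0 < x i ∧ x i < 1} ⊆ {x : Fin m → ℝ | ∀ i, 0 < x i ∧ x i < 1}) →
        (∀ k l, k ≠ l → volume (Φ k '' {x : Fin m → ℝ | ∀ i, 0 < x i ∧ x i < 1} ∩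
          Φ l '' {x : Fin m → ℝ | ∀ i, 0 < x i ∧ x i < 1}) = 0) →
        volume ({x : Fin m → ℝ | ∀ i, 0 < x i ∧ x i < 1} \
          ⋃ k, Φ k '' {x : Fin m → ℝ | ∀ i, 0 < x i ∧ x i < 1}) = 0 →
        (∀ k, IsSemialgebraicFunOn ℚ {x : Fin m → ℝ | ∀ i, 0 < x i ∧ x i < 1} (fun x => |(Φ' k x).det|)) →
        (∀ k, AnalyticOnNhd ℝ (h k) {x : Fin m → ℝ | ∀ i, 0 ≤ x i ∧ x i ≤ 1}) →
        (∀ k, ∀ x ∈ {x : Fin m → ℝ | ∀ i, 0 < x i ∧ x i < 1},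
          v.integrand (Φ k x) * |(Φ' k x).det| = h k x) →
        ∃ c ∈ AddSubgroup.closure {d : FormalRep | ∃ (n : ℕ) (r : IntegralRep n),
          r.domain = {x : Fin n → ℝ | ∀ i, 0 ≤ x i ∧ x i ≤ 1} ∧
          AnalyticOnNhd ℝ r.integrand {x : Fin n → ℝ | ∀ i, 0 ≤ x i ∧ x i ≤ 1} ∧ d = of r},
          of v - c ∈ relations) :
    ∀ (m : ℕ) (v : IntegralRep m),
      v.domain = {x : Fin m → ℝ | ∀ i, 0 < x i ∧ x i < 1} →
      AnalyticOnNhd ℝ v.integrand {x : Fin m → ℝ | ∀ i, 0 < x i ∧ x i < 1} →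
      ∃ c ∈ AddSubgroup.closure {d : FormalRep | ∃ (n : ℕ) (r : IntegralRep n),
        r.domain = {x : Fin n → ℝ | ∀ i, 0 ≤ x i ∧ x i ≤ 1} ∧
        AnalyticOnNhd ℝ r.integrand {x : Fin n → ℝ | ∀ i, 0 ≤ x i ∧ x i ≤ 1} ∧ d = of r},
        of v - c ∈ relations := by
  intro m v hvd hva
  -- the integrand is `ℚ`-semialgebraic and integrable on the open cube (fields of `v`)
  have hsa : IsSemialgebraicFunOn ℚ {x : Fin m → ℝ | ∀ i, 0 < x i ∧ x i < 1} v.integrand :=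
    hvd ▸ v.isSemialgebraicFunOn_integrand
  have hint : IntegrableOn v.integrand {x : Fin m → ℝ | ∀ i, 0 < x i ∧ x i < 1} :=
    hvd ▸ v.integrableOn
  -- T: the Laurent tiling
  obtain ⟨K, Φ, Φ', g, A, hΦs, hΦd, hΦi, hΦU, hdisj, hcov, hdet, hga, hgJ⟩ :=
    hT m v.integrand hsa hva hint
  -- E, chart by chart: the Laurent-tame pull-back is integrable (Jacobian formula), hence tame
  have hmeas : MeasurableSet {x : Fin m → ℝ | ∀ i, 0 < x i ∧ x i < 1} :=
    (isOpen_openCube' m).measurableSet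
  have htame : ∀ k, ∃ h : (Fin m → ℝ) → ℝ,
      AnalyticOnNhd ℝ h {x : Fin m → ℝ | ∀ i, 0 ≤ x i ∧ x i ≤ 1} ∧
      EqOn h (fun x => g k x / ∏ i, x i ^ (A k i)) {x : Fin m → ℝ | ∀ i, 0 < x i ∧ x i < 1} := by
    intro k
    refine hE m (A k) (g k) (hga k) ?_
    have hJk : IntegrableOn v.integrand (Φ k '' {x : Fin m → ℝ | ∀ i, 0 < x i ∧ x i < 1}) :=
      hint.mono_set (hΦU k)
    have key := (integrableOn_image_iff_integrableOn_abs_det_fderiv_smul volume hmeas (hΦd k) (hΦi k)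
      v.integrand).1 hJk
    refine key.congr_fun (fun x hx => ?_) hmeas
    dsimp only
    rw [smul_eq_mul, mul_comm, hgJ k x hx]
  choose h hha hhg using htame
  -- S: run the moves
  refine hS m v hvd K Φ Φ' h hΦs hΦd hΦi hΦU hdisj hcov hdet hha fun k x hx => ?_
  rw [hgJ k x hx, (hhg k) hx]

/-- **G** — `stub_openCubeNashResolution` of line `nash-rectilinearisation` (item 17978), VERBATIM, now
derived from this line's three stubs. [folklore] -/
theorem openCubeNashResolution_of : ∀ (m : ℕ) (v : IntegralRep m),
    v.domain = {x : Fin m → ℝ | ∀ i, 0 < x i ∧ x i < 1} →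
    AnalyticOnNhd ℝ v.integrand {x : Fin m → ℝ | ∀ i, 0 < x i ∧ x i < 1} →
    ∃ c ∈ AddSubgroup.closure {d : FormalRep | ∃ (n : ℕ) (r : IntegralRep n),
      r.domain = {x : Fin n → ℝ | ∀ i, 0 ≤ x i ∧ x i ≤ 1} ∧
      AnalyticOnNhd ℝ r.integrand {x : Fin n → ℝ | ∀ i, 0 ≤ x i ∧ x i ≤ 1} ∧ d = of r},
      of v - c ∈ relations :=
  openCubeNashResolution_of_stubs stub_laurentTiling stub_integrableLaurentExtends stub_tilingToTame

/-- **`nashCellReduction` — the first stub of item 17978, a THEOREM** (the 10813 lead's landed conditional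
stub F applied to its landed ingredients A, B, C, D; copied from skeleton v7 of line
`effective-cube-surjection`). [cite: BochnakCosteRoy1998, Prop. 2.9.10] -/
theorem nashCellReduction : ∀ (m : ℕ) (K : IntegralRep m), Bornology.IsBounded K.domain →
    (∀ x ∈ K.domain, K.integrand x = 1) →
    ∃ c ∈ AddSubgroup.closure {d : FormalRep | ∃ v : IntegralRep m,
      v.domain = {x : Fin m → ℝ | ∀ i, 0 < x i ∧ x i < 1} ∧
      AnalyticOnNhd ℝ v.integrand {x : Fin m → ℝ | ∀ i, 0 < x i ∧ x i < 1} ∧ d = of v},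
      of K - c ∈ relations :=
  stub_nashCellReductionOf stub_saAnalyticOffSmall stub_affineOpenBand stub_cadRefine stub_cadCellFacts

/-- Closure induction: if every generator of `S` is congruent modulo relations to an element of the
subgroup `T`, so is every element of `closure S` (as in the parent line). [folklore] -/
theorem closure_reduces {S : Set FormalRep} {T : AddSubgroup FormalRep}
    (h : ∀ s ∈ S, ∃ t ∈ T, s - t ∈ relations) :
    ∀ c ∈ AddSubgroup.closure S, ∃ t ∈ T, c - t ∈ relations := by
  intro c hc
  induction hc using AddSubgroup.closure_induction with
  | mem x hx => exact h x hx
  | zero => exact ⟨0, T.zero_mem, by simp⟩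
  | add x y _ _ hx hy =>
    obtain ⟨a, ha, hxa⟩ := hx
    obtain ⟨b, hb, hyb⟩ := hy
    refine ⟨a + b, T.add_mem ha hb, ?_⟩
    have : x + y - (a + b) = (x - a) + (y - b) := by abel
    rw [this]
    exact relations.add_mem hxa hyb
  | neg x _ hx =>
    obtain ⟨a, ha, hxa⟩ := hx
    refine ⟨-a, T.neg_mem ha, ?_⟩
    have : -x - -a = -(x - a) := by abel
    rw [this]
    exact relations.neg_mem hxa

/-- **THE COMPOSITION for item 17978** — `CubeResolution` BY NAME: bounded volumes → open-cube Nash span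
(`nashCellReduction`, theorem) → tame span generator by generator (`openCubeNashResolution_of`, from T, E,
S) → every representation (Viu-Sos, `cubeResolution_of_boundedVolumes`, landed).
[cite: ViuSos2021, Thm. 1.1] [folklore] -/
theorem CubeResolution_of : CubeResolution := by
  have hvol : ∀ (m : ℕ) (K : IntegralRep m), Bornology.IsBounded K.domain →
      (∀ x ∈ K.domain, K.integrand x = 1) → ∃ c : FormalRep, c ∈ cubicalSpan ∧ of K - c ∈ relations := by
    intro m K hb h1
    obtain ⟨c₁, hc₁, hK⟩ := nashCellReduction m K hb h1
    have hgen : ∀ s ∈ {d : FormalRep | ∃ v : IntegralRep m,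
        v.domain = {x : Fin m → ℝ | ∀ i, 0 < x i ∧ x i < 1} ∧
        AnalyticOnNhd ℝ v.integrand {x : Fin m → ℝ | ∀ i, 0 < x i ∧ x i < 1} ∧ d = of v},
        ∃ t ∈ cubicalSpan, s - t ∈ relations := by
      rintro s ⟨v, hvd, hva, rfl⟩
      obtain ⟨t, ht, hvt⟩ := openCubeNashResolution_of m v hvd hva
      exact ⟨t, ht, hvt⟩
    obtain ⟨c₂, hc₂, h₁₂⟩ := closure_reduces hgen c₁ hc₁
    refine ⟨c₂, hc₂, ?_⟩
    have : of K - c₂ = (of K - c₁) + (c₁ - c₂) := by abel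
    rw [this]
    exact relations.add_mem hK h₁₂
  intro N u
  obtain ⟨c, hc, huc⟩ := cubeResolution_of_boundedVolumes hvol N u
  exact ⟨c, hc, huc⟩

/-- **THE COMPOSITION for item 3407** — `ReductionRigidity` BY NAME from this line's three stubs and the
route item `AyoubEffectiveCubeKernel` (stmt-18116, Ayoub 2015 Conj. 1.1 at `k = ℚ`, the declared
transcendence leaf, taken as a NAMED HYPOTHESIS — it is an item, not a stub of this line), through the
landed glue `reductionRigidityOfCubes_proof` (item 18142). [cite: Ayoub2015, Conj. 1.1] [folklore] -/
theorem ReductionRigidity_of_ayoub (hH : AyoubEffectiveCubeKernel) : ReductionRigidity :=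
  Summit.KontsevichZagierPeriods.HermiteRigidity.ReductionRigidityOfCubes.reductionRigidityOfCubes_proof
    CubeResolution_of hH

end Summit.KontsevichZagierPeriods.KontsevichZagierPeriods.Cruxes.CubeResolution.LaurentTiling
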